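import Literature.NumberTheory.EllipticCurves.HuShuYin2019.SylvesterCMPointsConductorNineP
import Literature.NumberTheory.EllipticCurves.HeegnerTraceRelationOrdersProofs
import HarnessLib

/-!
# (ES1) along Hu–Shu–Yin's CM tower on `X₀(3⁵)`: `Tr_{K[9pnℓ]/K[9pn]} y(nℓ) = a_ℓ · y(n)` — PROVED
# (Nekovář 2007 Prop. (4.13) (i) / Gross 1991 Prop. 3.7 (1) at `N = 3⁵`, `K = ℚ(√−3)`, conductor `9pn`)

Topic `NumberTheory/EllipticCurves/HuShuYin2019`, namespace
`Literature.NumberTheory.EllipticCurves.HuShuYin2019`.  ONE theorem; no definition, no named fact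
(D-0026).  The instance of `HeegnerTraceOrders.sum_pointGalHom_eq_lFunction_smul_of_fix`
(`HeegnerTraceRelationOrdersProofs.lean`: the trace relation for a `K[f]`-rational CM point of `Y₀(N)`
and a Hecke `ℓ`-neighbour given by a primitive Heegner form of conductor `ℓf`) at the tower of
`SylvesterCMPointsConductorNineP.lean`: base `x(n) = τ_{Q^{(n)}}`, `Q^{(n)} = (n²A, nB, C)` the
level-`243` Heegner form of conductor `9pn` above HSY's `P₁ = [τ, 1] ∈ X₀(3⁵)(H_{9p})`
(`τ = (2pω − 9)/(9pω − 36)`, arXiv 1708.05266 p. 10 L92), moving point `x(nℓ) = x(n)/ℓ`; the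
`K[9pn]`-rationality `hfix` is `levelTransport_self_sylvesterPoint_of_fix`, the primitivity input
`ℓ ∤ C` is `not_dvd_C_of_prime_mod_three_eq_two`.

**`sum_pointGalHom_eq_lFunction_smul_sylvesterTower`**: for `K` imaginary quadratic with `d_K = −3`,
`ι : K → ℂ`, ANY model `W/ℚ` with a datum `Dt : ModularParametrizationData W 243` (HSY's
`f : X₀(3⁵) → E₉`, `f(∞) = O`), `p ≡ 1 (mod 3)`, `n ≥ 1` a product of primes `≡ 2 (mod 3)`, `ℓ ≡ 2 (mod 3)`
a prime with `ℓ ∤ pn` and `(ℓ)` prime in `𝓞_K`, any finset `G` enumerating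
`G_ℓ = Gal(K[9pnℓ]/K[9pn]) = ringClassGalOver ι (9p(nℓ)) (9pn)`, and points `y, y₀ ∈ E(K[9pnℓ])` over
`φ(x(nℓ))`, `φ(x(n))` (the data convention of `KolyvaginHeegnerData.map_y`):
  `Σ_{g ∈ G} g • y = a_ℓ • y₀` in `E(K[9pnℓ])`, `a_ℓ = W.LFunction ℓ`.
This is memo two §57.3 (ES1) "`Tr_{H_{9pnℓ}/H_{9pn}} y_{nℓ} = a_ℓ(E₉)·y_n`" for the rows of crux 19804
(VARIANT K): with the tree's `KolyvaginEuler.grAct_traceElt_mem_of_eq_smul` /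
`smul_kolyvaginPoint_sub_mem` and `2^M ∣ a_ℓ`, `2^M ∣ ℓ + 1` it gives the `Γ`-invariance of the derived
point modulo `2^M` (their displayed `hfin`).  Nothing about `Sel`, `Ш`, `a_ℓ(E₉) = 0` or BSD is asserted.

## References
* J. Nekovář, *The Euler system method for CM points on Shimura curves*, LMS LNS 320 (2007),
  Prop. (4.13) (i) (PDF p. 0573 L3 of `book:burns2007-l-functions-galois-representations`). [Nekovar2007]
* B. H. Gross, *Kolyvagin's work on modular elliptic curves*, LMS LNS 153 (1991), Prop. 3.7 (1)
  (p. 240). [GrossLMS1991]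
* Y. Hu, J. Shu, H. Yin, *An explicit Gross–Zagier formula related to the Sylvester conjecture*,
  Trans. AMS 372 (2019); arXiv 1708.05266 §4.1 (p. 10 L59, L92). [HuShuYin2019]

## Mathlib / tree search
Tree: `HeegnerTraceOrders.sum_pointGalHom_eq_lFunction_smul_of_fix` (`HeegnerTraceRelationOrdersProofs`);
`sylvesterForm_mem_heegnerForms`, `levelTransport_self_sylvesterPoint_of_fix`,
`isCoprime_C_of_forall_prime_mod_three_eq_two` (`SylvesterCMPointsConductorNineP`);
`isHeckeNeighbour_heegnerTau_conductorMul` (`HeegnerFormsConductorMul`).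
`lean search 'sylvesterTower'` → nothing before this file.  presearch: port/instance of tree theorems
([corpus:book:burns2007-l-functions-galois-representations p0573], [corpus:paper:arxiv-1708.05266 p0010]).
-/

noncomputable section

open Complex UpperHalfPlane CongruenceSubgroup PeriodPair NumberField
open scoped MatrixGroups

namespace Literature.NumberTheory.EllipticCurves.HuShuYin2019

open Literature.NumberTheory.EllipticCurves Literature.NumberTheory.EllipticCurves.ModularForms
  Literature.NumberTheory.QuadraticFields.BinaryQuadraticForm
  Literature.NumberTheory.QuadraticFields.Quadratic

variable {K : Type} [Field K] [NumberField K]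

/-! ### (ES1) along HSY's tower: `Tr_{K[9pnℓ]/K[9pn]} y(nℓ) = a_ℓ · y(n)` -/

/-- **(ES1) for Hu–Shu–Yin's CM tower on `X₀(3⁵)` — the trace relation the rows of crux 19804 display
as `hfin`'s input, now a THEOREM.**  Let `K` be imaginary quadratic with `d_K = −3`, `ι : K → ℂ`,
`W/ℚ` any model with a datum `Dt : ModularParametrizationData W 243` (`φ = Dt.φ : ℋ → E(ℂ)`, HSY's
`f : X₀(3⁵) → E₉`), `p ≡ 1 (mod 3)`, `n ≥ 1` a product of primes `≡ 2 (mod 3)` (square-freeness not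
needed), `ℓ ≡ 2 (mod 3)` a prime with `ℓ ∤ pn` and `(ℓ)` prime in `𝓞_K`.  With the level-`243` Heegner
forms `Q^{(m)} = (m²A, mB, C)` of conductor `9pm` (`A, B, C` as above; `x(m) = τ/m`, `x(1) = P₁`): for
every `y ∈ E(K[9p·nℓ])` over `φ(x(nℓ))` and `y₀ ∈ E(K[9p·nℓ])` over `φ(x(n))`, and any finset `G`
enumerating `G_ℓ = Gal(K[9pnℓ]/K[9pn])`,
  `Σ_{g ∈ G} g • y = a_ℓ • y₀` in `E(K[9pnℓ])`, `a_ℓ = W.LFunction ℓ`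
— Nekovář 2007 Prop. (4.13) (i) / Gross 1991 Prop. 3.7 (1) at HSY's frame (memo two §57.3 (ES1):
"`Tr_{H_{9pnℓ}/H_{9pn}} y_{nℓ} = a_ℓ(E_9)·y_n`"), from `HeegnerTraceOrders.sum_pointGalHom_eq_lFunction_smul_of_fix`
with `hfix = levelTransport_self_sylvesterPoint_of_fix`, `ℓ ∤ C` (`not_dvd_C_of_prime_mod_three_eq_two`).
With the tree's `KolyvaginEuler.grAct_traceElt_mem_of_eq_smul` / `smul_kolyvaginPoint_sub_mem` and
`a_ℓ ≡ 0 (mod 2^M)` this yields the `Γ`-invariance `hfin` of the derived point.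
[cite: Nekovar2007, Prop. (4.13) (i) (p. 0573)] [cite: GrossLMS1991, Prop. 3.7 (1) (p. 240)]
[cite: HuShuYin2019, §4.1 (p. 10 L92)] -/
theorem sum_pointGalHom_eq_lFunction_smul_sylvesterTower (hK : IsImaginaryQuadratic K)
    (hdK : NumberField.discr K = -3) (ι : K →+* ℂ) {W : WeierstrassCurve ℚ}
    (Dt : ModularParametrizationData W 243) {p n ℓ : ℕ} (hp : p % 3 = 1) (hn : n ≠ 0)
    (hn3 : ∀ q ∈ n.primeFactors, q % 3 = 2) (hℓ : ℓ.Prime) (hℓ3 : ℓ % 3 = 2) (hℓpn : ¬ ℓ ∣ p * n)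
    (hinert : (Ideal.span {(ℓ : 𝓞 K)}).IsPrime)
    {G : Finset (ringClassField K ι (9 * p * (n * ℓ)) ≃ₐ[ℚ] ringClassField K ι (9 * p * (n * ℓ)))}
    (hG : ∀ g, g ∈ G ↔ g ∈ ringClassGalOver ι (9 * p * (n * ℓ)) (9 * p * n))
    {y y₀ : (W.baseChange (ringClassField K ι (9 * p * (n * ℓ)))).toAffine.Point}
    (hy : WeierstrassCurve.Affine.Point.map (W' := W)
        (ringClassField K ι (9 * p * (n * ℓ))).subtype.toRatAlgHom y =
      Dt.φ (heegnerTau (((n * ℓ : ℕ) : ℤ) ^ 2 * (81 * ((p : ℤ) ^ 2 + 4 * p + 16)),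
        ((n * ℓ : ℕ) : ℤ) * (-(9 * (4 * (p : ℤ) ^ 2 + 17 * p + 72))), 4 * (p : ℤ) ^ 2 + 18 * p + 81)))
    (hy₀ : WeierstrassCurve.Affine.Point.map (W' := W)
        (ringClassField K ι (9 * p * (n * ℓ))).subtype.toRatAlgHom y₀ =
      Dt.φ (heegnerTau ((n : ℤ) ^ 2 * (81 * ((p : ℤ) ^ 2 + 4 * p + 16)),
        (n : ℤ) * (-(9 * (4 * (p : ℤ) ^ 2 + 17 * p + 72))), 4 * (p : ℤ) ^ 2 + 18 * p + 81))) :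
    ∑ g ∈ G, pointGalHom W (ringClassField K ι (9 * p * (n * ℓ))) g y = W.LFunction ℓ • y₀ := by
  haveI : NeZero (243 : ℕ) := ⟨by norm_num⟩
  have hp0 : p ≠ 0 := by rintro rfl; simp at hp
  have hℓ3' : ℓ ≠ 3 := by rintro rfl; simp at hℓ3
  have hℓN : ¬ ℓ ∣ 243 := by
    intro h
    have h' : ℓ ∣ 3 ^ 5 := by norm_num; exact h
    exact hℓ3' ((Nat.prime_dvd_prime_iff_eq hℓ Nat.prime_three).mp (hℓ.dvd_of_dvd_pow h'))
  have hℓ9 : ¬ ℓ ∣ 9 := by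
    intro h
    have h' : ℓ ∣ 3 ^ 2 := by norm_num; exact h
    exact hℓ3' ((Nat.prime_dvd_prime_iff_eq hℓ Nat.prime_three).mp (hℓ.dvd_of_dvd_pow h'))
  have hℓf : ¬ ℓ ∣ 9 * p * n := by
    intro h
    rw [mul_assoc] at h
    rcases (Nat.Prime.dvd_mul hℓ).mp h with h9 | hpn
    · exact hℓ9 h9
    · exact hℓpn hpn
  have hf : 9 * p * n ≠ 0 := mul_ne_zero (mul_ne_zero (by norm_num) hp0) hn
  have hunits : 2 ≤ 9 * p * n ∨ NumberField.discr K < -4 := by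
    left
    have : 1 ≤ p * n := Nat.one_le_iff_ne_zero.mpr (mul_ne_zero hp0 hn)
    nlinarith
  have hlev : ℓ * (9 * p * n) = 9 * p * (n * ℓ) := by ring
  have h3n : ¬ 3 ∣ n := fun h => by
    have := hn3 3 (Nat.mem_primeFactors.mpr ⟨Nat.prime_three, h, hn⟩)
    omega
  have hnC := isCoprime_C_of_forall_prime_mod_three_eq_two (p := p) hn hn3
  -- the form of conductor `9p·nℓ` and its data
  have hnℓ : n * ℓ ≠ 0 := mul_ne_zero hn hℓ.ne_zero
  have hnℓ3 : ∀ q ∈ (n * ℓ).primeFactors, q % 3 = 2 := by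
    intro q hq
    rw [Nat.primeFactors_mul hn hℓ.ne_zero, Finset.mem_union] at hq
    rcases hq with hq | hq
    · exact hn3 q hq
    · rw [hℓ.primeFactors, Finset.mem_singleton] at hq
      rw [hq]; exact hℓ3
  have hnℓC := isCoprime_C_of_forall_prime_mod_three_eq_two (p := p) hnℓ hnℓ3
  have hQ' := sylvesterForm_mem_heegnerForms hp hnℓ hnℓC
  have hQ := sylvesterForm_mem_heegnerForms hp hn hnC
  have hQeq : ((((n * ℓ : ℕ) : ℤ)) ^ 2 * (81 * ((p : ℤ) ^ 2 + 4 * p + 16)),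
      ((n * ℓ : ℕ) : ℤ) * (-(9 * (4 * (p : ℤ) ^ 2 + 17 * p + 72))), 4 * (p : ℤ) ^ 2 + 18 * p + 81) =
      ((ℓ : ℤ) ^ 2 * ((n : ℤ) ^ 2 * (81 * ((p : ℤ) ^ 2 + 4 * p + 16))),
        (ℓ : ℤ) * ((n : ℤ) * (-(9 * (4 * (p : ℤ) ^ 2 + 17 * p + 72)))), 4 * (p : ℤ) ^ 2 + 18 * p + 81) := by
    ext <;> push_cast <;> ring
  have hD : (((n : ℤ)) ^ 2 * (81 * ((p : ℤ) ^ 2 + 4 * p + 16)),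
      (n : ℤ) * (-(9 * (4 * (p : ℤ) ^ 2 + 17 * p + 72))), 4 * (p : ℤ) ^ 2 + 18 * p + 81).2.1 ^ 2 -
      4 * ((n : ℤ) ^ 2 * (81 * ((p : ℤ) ^ 2 + 4 * p + 16)), (n : ℤ) * (-(9 * (4 * (p : ℤ) ^ 2 + 17 * p + 72))),
        4 * (p : ℤ) ^ 2 + 18 * p + 81).1 * ((n : ℤ) ^ 2 * (81 * ((p : ℤ) ^ 2 + 4 * p + 16)),
          (n : ℤ) * (-(9 * (4 * (p : ℤ) ^ 2 + 17 * p + 72))), 4 * (p : ℤ) ^ 2 + 18 * p + 81).2.2 < 0 := by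
    rw [hQ.1]
    have : (0 : ℤ) < ((9 * p * n : ℕ) : ℤ) ^ 2 := by positivity
    linarith
  have hx' : IsHeckeNeighbour 243 ℓ
      (heegnerTau ((n : ℤ) ^ 2 * (81 * ((p : ℤ) ^ 2 + 4 * p + 16)),
        (n : ℤ) * (-(9 * (4 * (p : ℤ) ^ 2 + 17 * p + 72))), 4 * (p : ℤ) ^ 2 + 18 * p + 81))
      (heegnerTau ((((n * ℓ : ℕ) : ℤ)) ^ 2 * (81 * ((p : ℤ) ^ 2 + 4 * p + 16)),
        ((n * ℓ : ℕ) : ℤ) * (-(9 * (4 * (p : ℤ) ^ 2 + 17 * p + 72))), 4 * (p : ℤ) ^ 2 + 18 * p + 81)) := by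
    rw [hQeq]
    exact isHeckeNeighbour_heegnerTau_conductorMul hQ.2.1 hD hℓ
  have hQ'disc : discr ((((n * ℓ : ℕ) : ℤ)) ^ 2 * (81 * ((p : ℤ) ^ 2 + 4 * p + 16)),
      ((n * ℓ : ℕ) : ℤ) * (-(9 * (4 * (p : ℤ) ^ 2 + 17 * p + 72))), 4 * (p : ℤ) ^ 2 + 18 * p + 81) =
      ((9 * p * (n * ℓ) : ℕ) : ℤ) ^ 2 * NumberField.discr K := by
    rw [hdK]; exact hQ'.1
  exact HeegnerTraceOrders.sum_pointGalHom_eq_lFunction_smul_of_fix hK ι Dt hℓ hinert hℓN hℓf hf hunits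
    hlev (fun σ hσ => levelTransport_self_sylvesterPoint_of_fix hK hdK ι hp hn h3n hnC hσ) hQ'.2.1
    ((isPrimitive_iff_binQF _).mpr ((BinQF.isPrimitive_iff _).mpr hQ'.2.2.2)) hQ'disc hx' hG hy hy₀


end Literature.NumberTheory.EllipticCurves.HuShuYin2019

end
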